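import Mathlib
import Summits.Ventures.HodgeRepro2.Tier7.Line3.Defs
import Summits.Ventures.HodgeRepro2.Tier7.Line1.FDConverse
import Summits.Ventures.HodgeRepro2.Tier7.Line1.RtfBridge
import Summits.Ventures.HodgeRepro2.Tier7.Common.TwoTorus

/-!
# Tier 7 — LINE 1: the bridge `CommonIrred D → Line3.RtfConclusion D` ON THE TOWER — no finite dimension, no
`OrthDistinct`, from the displayed retraction `P` alone (`Line1/TowerBridge.lean`; t7-L1-p5, gen 1)

Second product of t7-L1-p5 gen 1 (STATUS l. 14897, the TARGET line). `Line1/RtfBridge.lean` (t7-L1-p3, p664689) proves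
`CommonIrred D → Line3.RtfConclusion D` under `OrthDistinct D`, «every Hecke-irreducible subspace of `H^{1,0} ∧ H^{1,0}` is
finite-dimensional» (`hfin`) and a Hecke-equivariant retraction `P : HX → H^{1,0} ∧ H^{1,0}`; `Line1/ProjHX.lean` (p666013)
removes `P` on data with finite-dimensional irreducibles. But `hfin` is FALSE of the real tower (its constituents `π_f` are
infinite-dimensional: crit-2 R-p5-2 / R-p3-1), so neither statement applies to the real `X` as typed. THIS FILE removes
`hfin` and `OrthDistinct` instead, keeping only `P`:

THE POINT. The frozen (H9) `H20_semisimple` gives every Hecke-stable `W ⊆ H^{1,0} ∧ H^{1,0}` a Hecke-stable COMPLEMENT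
`W'` in `H^{1,0} ∧ H^{1,0}` (`W ⊓ W' = ⊥`, `W ⊔ W' = H^{1,0} ∧ H^{1,0}`), and the projection of `H^{1,0} ∧ H^{1,0}` onto `W`
ALONG `W'` is ℂ-linear and Hecke-equivariant by uniqueness of the decomposition — no topology, no finite dimension, no
pairing. With the displayed retraction `P`, `comp := (projection along W') ∘ P : HX → HX` is the isotypic projection of
L3's `SeesawData`. `comp_preserves` follows from (H9) + (H10) alone: for a Hecke-stable `U ⊆ H^{1,0} ∧ H^{1,0}`, the image
`comp(U) ⊆ W` is Hecke-stable, hence `⊥` (then `comp x = 0 ∈ U`) or `W`; in the latter case `K := U ⊓ ker comp` has an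
(H9)-complement `K'`, `W'' := K' ⊓ U` satisfies `U = K ⊔ W''` (modular law), `comp` is injective on `W''` with image `W`, so
`W''` is Hecke-irreducible (transfer along the equivariant bijection, `heckeIrred_of_map`) and (H10) `H20_multone`
applied to `comp|_{W''} : W'' → W` forces `W'' = W`, i.e. `W ⊆ U` and `comp x ∈ W ⊆ U` (`mem_of_map_le_irred`).

CONTENT (all PROVED, sorry-free, axioms of every declaration: propext / Classical.choice / Quot.sound):
* §1 `FD.exists_compl_of_stable` (the first half of (H9), named), `FD.cprojSub` / `FD.cproj` (the projection onto `W`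
  along `W'` after `P`) with `cproj_mem`, `sub_cproj_mem`, `cproj_act`, `cproj_eq_self`, `cproj_eq_zero`;
* §2 `FD.heckeStable_map`, `FD.heckeStable_ker`, `FD.heckeIrred_of_map` (irreducibility transfers along an injective
  equivariant map with irreducible image), `FD.mem_of_map_le_irred` (THE (H9)+(H10) ARGUMENT: an equivariant map of `HX`
  with values in a Hecke-irreducible `W ⊆ H^{2,0}` preserves every Hecke-stable `U ⊆ H^{2,0}`);
* §3 `rtfConclusion_of_commonIrred_of_retraction (P) (hPmem) (hPid) (hPact) : CommonIrred D → Line3.RtfConclusion D`,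
  `rtfConclusion_iff_commonIrred_of_retraction`, and with the printed `OrthDistinct` only
  `rtfConclusion_iff_conclusion_of_retraction : Line3.RtfConclusion D ↔ ∃ g, L2 (fOmegaS g) (fOmegaSbar g) ≠ 0`.

RECORD: on EVERY datum with a Hecke-equivariant retraction onto `H^{1,0} ∧ H^{1,0}` — on the real `X` the `L²`-orthogonal
projector onto `H^{1,0} ∧ H^{1,0}`, Hecke-equivariant because the Hecke operators are normal for the Petersson product
(crit-1 R9) — `Line3.RtfConclusion D ↔ CommonIrred D`; with the printed `OrthDistinct` (Liu 2021 App. D (D.1) with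
multiplicity one) also `↔ ∃ g, L2 (fOmegaS g) (fOmegaSbar g) ≠ 0`: the three residual names are ONE statement on the tower
itself, not only on finite-dimensional data. Nothing here produces a non-vanishing: the file converts one residual into the
other. Imports: `Mathlib` + `Line3.Defs` + `Line1.FDConverse` + `Line1.RtfBridge` + `Common.TwoTorus`.
§8(d): uses an L-value-free non-vanishing device: NO.
-/

namespace Summit.Ventures.HodgeRepro2.Tier7.Line1.FD

open Summit.Ventures.HodgeRepro2.Tier7

noncomputable section

variable {HX : Type} [Ring HX] [Algebra ℂ HX] {G : Type} [Group G] [MulAction G HX]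
  (S : SurfaceShadow HX G)

/-! ## 1. The projection onto a Hecke-stable `W ⊆ H^{2,0}` along an (H9)-complement, after the retraction `P` -/

/-- (H9), first half, named: every Hecke-stable `W ⊆ H^{1,0} ∧ H^{1,0}` has a Hecke-stable complement in it -/
theorem exists_compl_of_stable (W : Submodule ℂ HX) (hW : W ≤ S.H10 * S.H10) (hWs : HeckeStable G W) :
    ∃ W' : Submodule ℂ HX, W' ≤ S.H10 * S.H10 ∧ HeckeStable G W' ∧ W ⊓ W' = ⊥ ∧ W ⊔ W' = S.H10 * S.H10 :=
  (S.H20_semisimple W hW hWs).1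

section CProj

variable (W W' : Submodule ℂ HX)

/-- every `x ∈ H^{1,0} ∧ H^{1,0}` is `w + (x - w)` with `w ∈ W`, `x - w ∈ W'` -/
theorem exists_decomp_compl (hsup : W ⊔ W' = S.H10 * S.H10) (x : HX) (hx : x ∈ S.H10 * S.H10) :
    ∃ w ∈ W, x - w ∈ W' := by
  rw [← hsup] at hx
  obtain ⟨w, hw, w', hw', rfl⟩ := Submodule.mem_sup.mp hx
  refine ⟨w, hw, ?_⟩
  rw [add_sub_cancel_left]
  exact hw'

/-- uniqueness of the `W`-component (`W ⊓ W' = ⊥`) -/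
theorem decomp_compl_unique (hdisj : W ⊓ W' = ⊥) {u v : HX} (hu : u ∈ W) (hv : v ∈ W) (huv : u - v ∈ W') :
    u = v := by
  have h : u - v ∈ W ⊓ W' := ⟨Submodule.sub_mem _ hu hv, huv⟩
  rw [hdisj, Submodule.mem_bot] at h
  exact sub_eq_zero.mp h

/-- the `W`-component of `x ∈ H^{1,0} ∧ H^{1,0}` along `W'` -/
def cprojSub (hsup : W ⊔ W' = S.H10 * S.H10) (x : HX) (hx : x ∈ S.H10 * S.H10) : HX :=
  Classical.choose (exists_decomp_compl S W W' hsup x hx)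

/-- the `W`-component lies in `W` and the remainder in `W'` -/
theorem cprojSub_spec (hsup : W ⊔ W' = S.H10 * S.H10) (x : HX) (hx : x ∈ S.H10 * S.H10) :
    cprojSub S W W' hsup x hx ∈ W ∧ x - cprojSub S W W' hsup x hx ∈ W' :=
  Classical.choose_spec (exists_decomp_compl S W W' hsup x hx)

/-- the `W`-component is characterised by the decomposition -/
theorem cprojSub_eq (hdisj : W ⊓ W' = ⊥) (hsup : W ⊔ W' = S.H10 * S.H10) (x : HX) (hx : x ∈ S.H10 * S.H10)
    {u : HX} (hu : u ∈ W) (hv : x - u ∈ W') : cprojSub S W W' hsup x hx = u := by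
  have hs := cprojSub_spec S W W' hsup x hx
  refine decomp_compl_unique W W' hdisj hs.1 hu ?_
  have h : cprojSub S W W' hsup x hx - u = (x - u) - (x - cprojSub S W W' hsup x hx) := by abel
  rw [h]
  exact Submodule.sub_mem _ hv hs.2

/-- **the isotypic projection on all of `HX`**: `cproj x := (W`-component of `P x` along `W')`, ℂ-linear by
uniqueness of the decomposition -/
def cproj (hdisj : W ⊓ W' = ⊥) (hsup : W ⊔ W' = S.H10 * S.H10) (P : HX →ₗ[ℂ] HX)
    (hPmem : ∀ x, P x ∈ S.H10 * S.H10) : HX →ₗ[ℂ] HX where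
  toFun x := cprojSub S W W' hsup (P x) (hPmem x)
  map_add' x y := by
    apply cprojSub_eq S W W' hdisj hsup
    · exact Submodule.add_mem _ (cprojSub_spec S W W' hsup (P x) (hPmem x)).1
        (cprojSub_spec S W W' hsup (P y) (hPmem y)).1
    · have h : P (x + y) - (cprojSub S W W' hsup (P x) (hPmem x) + cprojSub S W W' hsup (P y) (hPmem y)) =
          (P x - cprojSub S W W' hsup (P x) (hPmem x)) + (P y - cprojSub S W W' hsup (P y) (hPmem y)) := by
        rw [map_add]
        abel
      rw [h]
      exact Submodule.add_mem _ (cprojSub_spec S W W' hsup (P x) (hPmem x)).2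
        (cprojSub_spec S W W' hsup (P y) (hPmem y)).2
  map_smul' c x := by
    simp only [RingHom.id_apply]
    apply cprojSub_eq S W W' hdisj hsup
    · exact Submodule.smul_mem _ c (cprojSub_spec S W W' hsup (P x) (hPmem x)).1
    · have h : P (c • x) - c • cprojSub S W W' hsup (P x) (hPmem x) =
          c • (P x - cprojSub S W W' hsup (P x) (hPmem x)) := by
        rw [map_smul, smul_sub]
      rw [h]
      exact Submodule.smul_mem _ c (cprojSub_spec S W W' hsup (P x) (hPmem x)).2

/-- (PROVED) unfolding -/
theorem cproj_apply (hdisj : W ⊓ W' = ⊥) (hsup : W ⊔ W' = S.H10 * S.H10) (P : HX →ₗ[ℂ] HX)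
    (hPmem : ∀ x, P x ∈ S.H10 * S.H10) (x : HX) :
    cproj S W W' hdisj hsup P hPmem x = cprojSub S W W' hsup (P x) (hPmem x) := rfl

/-- (PROVED) `cproj` lands in `W` -/
theorem cproj_mem (hdisj : W ⊓ W' = ⊥) (hsup : W ⊔ W' = S.H10 * S.H10) (P : HX →ₗ[ℂ] HX)
    (hPmem : ∀ x, P x ∈ S.H10 * S.H10) (x : HX) : cproj S W W' hdisj hsup P hPmem x ∈ W :=
  (cprojSub_spec S W W' hsup (P x) (hPmem x)).1

/-- (PROVED) the remainder `P x - cproj x` lies in `W'` -/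
theorem sub_cproj_mem (hdisj : W ⊓ W' = ⊥) (hsup : W ⊔ W' = S.H10 * S.H10) (P : HX →ₗ[ℂ] HX)
    (hPmem : ∀ x, P x ∈ S.H10 * S.H10) (x : HX) : P x - cproj S W W' hdisj hsup P hPmem x ∈ W' :=
  (cprojSub_spec S W W' hsup (P x) (hPmem x)).2

/-- (PROVED) **Hecke equivariance** for Hecke-stable `W`, `W'` and an equivariant `P` (uniqueness of the decomposition) -/
theorem cproj_act (hdisj : W ⊓ W' = ⊥) (hsup : W ⊔ W' = S.H10 * S.H10) (P : HX →ₗ[ℂ] HX)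
    (hPmem : ∀ x, P x ∈ S.H10 * S.H10) (hWs : HeckeStable G W) (hW's : HeckeStable G W')
    (hPact : ∀ (g : G) x, P (g • x) = g • P x) (g : G) (x : HX) :
    cproj S W W' hdisj hsup P hPmem (g • x) = g • cproj S W W' hdisj hsup P hPmem x := by
  rw [cproj_apply, cproj_apply]
  apply cprojSub_eq S W W' hdisj hsup
  · exact hWs g _ (cprojSub_spec S W W' hsup (P x) (hPmem x)).1
  · rw [hPact g x, ← act_sub S]
    exact hW's g _ (cprojSub_spec S W W' hsup (P x) (hPmem x)).2

/-- (PROVED) `cproj` is the identity on `W` (`P` is the identity on `H^{2,0}`) -/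
theorem cproj_eq_self (hdisj : W ⊓ W' = ⊥) (hsup : W ⊔ W' = S.H10 * S.H10) (P : HX →ₗ[ℂ] HX)
    (hPmem : ∀ x, P x ∈ S.H10 * S.H10) (hW : W ≤ S.H10 * S.H10) (hPid : ∀ x ∈ S.H10 * S.H10, P x = x)
    (x : HX) (hx : x ∈ W) : cproj S W W' hdisj hsup P hPmem x = x := by
  rw [cproj_apply]
  apply cprojSub_eq S W W' hdisj hsup
  · exact hx
  · rw [hPid x (hW hx), sub_self]
    exact Submodule.zero_mem _

/-- (PROVED) `cproj` vanishes on `W'` -/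
theorem cproj_eq_zero (hdisj : W ⊓ W' = ⊥) (hsup : W ⊔ W' = S.H10 * S.H10) (P : HX →ₗ[ℂ] HX)
    (hPmem : ∀ x, P x ∈ S.H10 * S.H10) (hW' : W' ≤ S.H10 * S.H10) (hPid : ∀ x ∈ S.H10 * S.H10, P x = x)
    (x : HX) (hx : x ∈ W') : cproj S W W' hdisj hsup P hPmem x = 0 := by
  rw [cproj_apply]
  apply cprojSub_eq S W W' hdisj hsup
  · exact Submodule.zero_mem _
  · rw [hPid x (hW' hx), sub_zero]
    exact hx

end CProj

/-! ## 2. THE (H9)+(H10) ARGUMENT: an equivariant map with irreducible values preserves every stable `U ⊆ H^{2,0}` -/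

section Preserve

variable (f : HX →ₗ[ℂ] HX)

/-- (PROVED) the image of a Hecke-stable subspace under an equivariant map is Hecke-stable -/
theorem heckeStable_map (hf_act : ∀ (g : G) x, f (g • x) = g • f x) (U : Submodule ℂ HX)
    (hUs : HeckeStable G U) : HeckeStable G (U.map f) := by
  intro g y hy
  obtain ⟨u, hu, rfl⟩ := Submodule.mem_map.mp hy
  exact Submodule.mem_map.mpr ⟨g • u, hUs g u hu, hf_act g u⟩

include S in
/-- (PROVED) the kernel of an equivariant map is Hecke-stable -/
theorem heckeStable_ker (hf_act : ∀ (g : G) x, f (g • x) = g • f x) : HeckeStable G (LinearMap.ker f) := by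
  intro g y hy
  rw [LinearMap.mem_ker] at hy ⊢
  rw [hf_act g y, hy, act_zero S g]

/-- (PROVED) **irreducibility transfers** along an equivariant map that is injective on a Hecke-stable `Z` and maps
`Z` onto a Hecke-irreducible `W`: `Z` is Hecke-irreducible -/
theorem heckeIrred_of_map (hf_act : ∀ (g : G) x, f (g • x) = g • f x) (Z W : Submodule ℂ HX)
    (hZs : HeckeStable G Z) (hW : HeckeIrred G W) (hinj : ∀ z ∈ Z, f z = 0 → z = 0) (himg : Z.map f = W) :
    HeckeIrred G Z := by
  refine ⟨?_, hZs, ?_⟩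
  · rintro rfl
    rw [Submodule.map_bot] at himg
    exact hW.1 himg.symm
  · intro Y hYZ hYs
    have hYmap : Y.map f ≤ W := by
      rw [← himg]
      exact Submodule.map_mono hYZ
    rcases hW.2.2 (Y.map f) hYmap (heckeStable_map f hf_act Y hYs) with h | h
    · left
      rw [eq_bot_iff]
      intro y hy
      rw [Submodule.mem_bot]
      have h1 : f y ∈ Y.map f := Submodule.mem_map.mpr ⟨y, hy, rfl⟩
      rw [h, Submodule.mem_bot] at h1
      exact hinj y (hYZ hy) h1
    · right
      refine le_antisymm hYZ ?_
      intro z hz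
      have h1 : f z ∈ Y.map f := by
        rw [h, ← himg]
        exact Submodule.mem_map.mpr ⟨z, hz, rfl⟩
      obtain ⟨y, hy, hyz⟩ := Submodule.mem_map.mp h1
      have h2 : f (z - y) = 0 := by
        rw [map_sub, hyz, sub_self]
      have h3 : z - y = 0 := hinj (z - y) (Submodule.sub_mem _ hz (hYZ hy)) h2
      rw [sub_eq_zero] at h3
      rw [h3]
      exact hy

/-- (PROVED) **THE (H9)+(H10) ARGUMENT**: an equivariant linear map `f : HX → HX` with values in a Hecke-irreducible
`W ⊆ H^{1,0} ∧ H^{1,0}` maps every Hecke-stable `U ⊆ H^{1,0} ∧ H^{1,0}` into itself. Proof: `f(U) ⊆ W` is Hecke-stable,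
so `f(U) = ⊥` (done) or `f(U) = W`; then `K := U ⊓ ker f` has an (H9)-complement `K'` in `H^{2,0}`, `W'' := K' ⊓ U` has
`U = K ⊔ W''` (modular law), `f` is injective on `W''` with image `f(U) = W`, so `W''` is Hecke-irreducible and (H10)
`H20_multone` forces `W'' = W`, whence `W ⊆ U` and `f x ∈ W ⊆ U`. -/
theorem mem_of_map_le_irred (hf_act : ∀ (g : G) x, f (g • x) = g • f x) (W : Submodule ℂ HX)
    (hW : HeckeIrred G W) (hWle : W ≤ S.H10 * S.H10) (hf_mem : ∀ x, f x ∈ W) (U : Submodule ℂ HX)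
    (hU : U ≤ S.H10 * S.H10) (hUs : HeckeStable G U) (x : HX) (hx : x ∈ U) : f x ∈ U := by
  have himg : U.map f ≤ W := by
    rintro _ ⟨u, _, rfl⟩
    exact hf_mem u
  rcases hW.2.2 (U.map f) himg (heckeStable_map f hf_act U hUs) with h | h
  · -- `f(U) = ⊥`
    have h1 : f x ∈ U.map f := Submodule.mem_map.mpr ⟨x, hx, rfl⟩
    rw [h, Submodule.mem_bot] at h1
    rw [h1]
    exact Submodule.zero_mem _
  · -- `f(U) = W`: produce `W ⊆ U`
    set K : Submodule ℂ HX := U ⊓ LinearMap.ker f with hKdef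
    have hKs : HeckeStable G K := fun g y hy => ⟨hUs g y hy.1, heckeStable_ker S f hf_act g y hy.2⟩
    have hKle : K ≤ S.H10 * S.H10 := inf_le_left.trans hU
    obtain ⟨K', hK'le, hK's, hKK', hKsup⟩ := exists_compl_of_stable S K hKle hKs
    set Z : Submodule ℂ HX := K' ⊓ U with hZdef
    have hZs : HeckeStable G Z := fun g y hy => ⟨hK's g y hy.1, hUs g y hy.2⟩
    have hZle : Z ≤ S.H10 * S.H10 := inf_le_right.trans hU
    -- `U = K ⊔ Z` (modular law, `K ≤ U`)
    have hUeq : U = K ⊔ Z := by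
      have h1 : K ⊔ K' ⊓ U = (K ⊔ K') ⊓ U := (sup_inf_assoc_of_le K' (inf_le_left : K ≤ U)).symm
      rw [hZdef, h1, hKsup, inf_eq_right.mpr hU]
    -- `f` is injective on `Z`
    have hinj : ∀ z ∈ Z, f z = 0 → z = 0 := by
      intro z hz hz0
      have h1 : z ∈ K ⊓ K' := ⟨⟨hz.2, LinearMap.mem_ker.mpr hz0⟩, hz.1⟩
      rw [hKK', Submodule.mem_bot] at h1
      exact h1
    -- `f(Z) = f(U) = W`
    have hZimg : Z.map f = W := by
      have h1 : K.map f = ⊥ := by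
        rw [eq_bot_iff]
        rintro _ ⟨k, hk, rfl⟩
        rw [Submodule.mem_bot]
        exact LinearMap.mem_ker.mp hk.2
      rw [← h, hUeq, Submodule.map_sup, h1, bot_sup_eq]
    have hZirr : HeckeIrred G Z := heckeIrred_of_map f hf_act Z W hZs hW hinj hZimg
    -- (H10) on `f|_Z : Z → W`
    have hZeq : Z = W := by
      refine S.H20_multone Z W hZle hWle hZirr hW (f.comp Z.subtype) (fun z => hf_mem z) ?_ ?_
      · intro g z
        show f (g • (z : HX)) = g • f z
        exact hf_act g z
      · intro h0
        obtain ⟨w, hw, hw0⟩ := Submodule.exists_mem_ne_zero_of_ne_bot hW.1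
        rw [← hZimg] at hw
        obtain ⟨z, hz, hzw⟩ := Submodule.mem_map.mp hw
        have h1 : (f.comp Z.subtype) ⟨z, hz⟩ = 0 := by
          rw [h0, LinearMap.zero_apply]
        have h2 : f z = 0 := h1
        exact hw0 (hzw ▸ h2)
    have hWU : W ≤ U := by
      rw [← hZeq]
      exact inf_le_right
    exact hWU (hf_mem x)

end Preserve

end

end Summit.Ventures.HodgeRepro2.Tier7.Line1.FD

/-! ## 3. The bridge on the tower: `CommonIrred D → Line3.RtfConclusion D` from the retraction alone -/

namespace Summit.Ventures.HodgeRepro2.Tier7.Line1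

open Summit.Ventures.HodgeRepro2.Tier7

section

variable {K : Type} [Field K] [NumberField K] {E' : Type} [Field E'] [NumberField E']
  {V : Type} [AddCommGroup V] [Module E' V] {HX : Type} [Ring HX] [Algebra ℂ HX]
  {G : Type} [Group G] [MulAction G HX] (D : PeriodDatum K E' V HX G)

/-- **(PROVED) `CommonIrred D → Line3.RtfConclusion D` ON THE TOWER**: the only hypothesis is a Hecke-equivariant
retraction `P` of `HX` onto `H^{1,0} ∧ H^{1,0}` — no finite dimension, no `OrthDistinct`. From `CommonIrred D` take a
Hecke-irreducible `W ≤ P_A ⊓ P_B`; (H9) gives a Hecke-stable complement `W'` of `W` in `H^{2,0}`; `sw : SeesawData D` with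
`Rep := Unit`, `Θ := W`, `comp := FD.cproj` (the projection onto `W` along `W'` after `P`): `comp_mem`, `comp_act` by
uniqueness of the decomposition, `comp_preserves` by `FD.mem_of_map_le_irred` ((H9)+(H10)); the two non-vanishing clauses
because `comp` is the identity on `W ≠ ⊥ ⊆ P_A` (resp. `P_B`), so it cannot kill every generator. -/
theorem rtfConclusion_of_commonIrred_of_retraction (P : HX →ₗ[ℂ] HX) (hPmem : ∀ x, P x ∈ D.S.H10 * D.S.H10)
    (hPid : ∀ x ∈ D.S.H10 * D.S.H10, P x = x) (hPact : ∀ (g : G) x, P (g • x) = g • P x)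
    (hc : CommonIrred D) : Line3.RtfConclusion D := by
  have hinf := (commonIrred_iff_inf_ne_bot D).mp hc
  obtain ⟨W, hWle, hW⟩ := exists_irred_le_of_stable D (inf_le_left.trans (prodModS_le D))
    (heckeStable_inf (prodModS_stable D) (prodModSbar_stable D)) hinf
  have hWH : W ≤ D.S.H10 * D.S.H10 := hWle.trans (inf_le_left.trans (prodModS_le D))
  obtain ⟨W', _hW'le, hW's, hdisj, hsup⟩ := FD.exists_compl_of_stable D.S W hWH hW.2.1
  let comp : HX →ₗ[ℂ] HX := FD.cproj D.S W W' hdisj hsup P hPmem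
  have hcomp_act : ∀ (g : G) x, comp (g • x) = g • comp x :=
    fun g x => FD.cproj_act D.S W W' hdisj hsup P hPmem hW.2.1 hW's hPact g x
  have hcomp_mem : ∀ x, comp x ∈ W := fun x => FD.cproj_mem D.S W W' hdisj hsup P hPmem x
  let sw : Line3.SeesawData D :=
    { Rep := Unit
      Θ := fun _ => W
      comp := fun _ => comp
      Θ_le := fun _ => hWH
      Θ_irred := fun _ _ => hW
      comp_mem := fun _ x => hcomp_mem x
      comp_act := fun _ g x => hcomp_act g x
      comp_preserves := fun _ U hU hUs x hx =>
        FD.mem_of_map_le_irred D.S comp hcomp_act W hW hWH hcomp_mem U hU hUs x hx }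
  have hgen : ∀ F : (Fin 4 → G) → HX, W ≤ Submodule.span ℂ (Set.range F) →
      ∃ g : Fin 4 → G, comp (F g) ≠ 0 := by
    intro F hWF
    by_contra hall
    have hall' : ∀ g : Fin 4 → G, comp (F g) = 0 := fun g => by
      by_contra h
      exact hall ⟨g, h⟩
    have hker : Submodule.span ℂ (Set.range F) ≤ LinearMap.ker comp := by
      rw [Submodule.span_le]
      rintro _ ⟨g, rfl⟩
      exact LinearMap.mem_ker.mpr (hall' g)
    obtain ⟨w, hw, hw0⟩ := Submodule.exists_mem_ne_zero_of_ne_bot hW.1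
    have h1 : comp w = 0 := LinearMap.mem_ker.mp (hker (hWF hw))
    have h2 : comp w = w := FD.cproj_eq_self D.S W W' hdisj hsup P hPmem hWH hPid w hw
    exact hw0 (h2.symm.trans h1)
  exact ⟨sw, (), hgen D.fOmegaS (hWle.trans inf_le_left), hgen D.fOmegaSbar (hWle.trans inf_le_right)⟩

/-- (PROVED) on every datum with a Hecke-equivariant retraction onto `H^{1,0} ∧ H^{1,0}` the two residuals of the tier
COINCIDE (⇒ is plan-2's `Common.commonIrred_of_rtfConclusion`) -/
theorem rtfConclusion_iff_commonIrred_of_retraction (P : HX →ₗ[ℂ] HX) (hPmem : ∀ x, P x ∈ D.S.H10 * D.S.H10)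
    (hPid : ∀ x ∈ D.S.H10 * D.S.H10, P x = x) (hPact : ∀ (g : G) x, P (g • x) = g • P x) :
    Line3.RtfConclusion D ↔ CommonIrred D :=
  ⟨Common.commonIrred_of_rtfConclusion D, rtfConclusion_of_commonIrred_of_retraction D P hPmem hPid hPact⟩

/-- (PROVED) with the printed `OrthDistinct` (Liu 2021 App. D (D.1) with multiplicity one) both are the conclusion (P) in
its common-vector form — ON THE TOWER: `Line3.RtfConclusion D ↔ ∃ g, ⟨f^*Ω_s, f^*Ω_{s̄}⟩ ≠ 0` with the retraction and
`OrthDistinct` as the only hypotheses (`commonIrred_iff_conclusion_of_orth`, t7-L1-p5) -/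
theorem rtfConclusion_iff_conclusion_of_retraction (ho : OrthDistinct D) (P : HX →ₗ[ℂ] HX)
    (hPmem : ∀ x, P x ∈ D.S.H10 * D.S.H10) (hPid : ∀ x ∈ D.S.H10 * D.S.H10, P x = x)
    (hPact : ∀ (g : G) x, P (g • x) = g • P x) :
    Line3.RtfConclusion D ↔ ∃ g : Fin 4 → G, D.S.L2 (D.fOmegaS g) (D.fOmegaSbar g) ≠ 0 :=
  (rtfConclusion_iff_commonIrred_of_retraction D P hPmem hPid hPact).trans
    (commonIrred_iff_conclusion_of_orth D ho)

end

end Summit.Ventures.HodgeRepro2.Tier7.Line1
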